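import Summits.QuantumFields.QCD.Theorems.QuarksAsStableActionCriticalLineDiamagnetismCellSecondOrderAux5

/-!
# B6 cell sub-stub `cellSecondOrder`, Aux 6: the row sum of the pair bubbles against `bubbleAbs 14 7`
(crux `stmt-QuantumFields-9734`, decl `Summit.QuantumFields.QCD.Theses.QuarksAsStableAction.CriticalLineDiamagnetism`,
line `Sketch`, Route B step B6; sub-problem context `Summits/QuantumFields/QCD/Statement.lean`)

* `exists_near`: odd-row partners within torus distance `7` of an odd-row cell link are projections of the planar pattern
  `CellKappa.nearLinks 7 l` (`l` a planar odd-row reference link), so the row sum over odd-row partners splits into the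
  list sum over the pattern plus the far tail (`rowSum_split`);
* `bubbleAbs_eq`: `bubbleAbs M s₀ s₁ 14 7` is `¼` of the sum over the two cell links `(0,1), (1,1)` of the SIGN-FREE planar
  four-term bubbles (the orientation signs of `linkBlocks` do not change absolute values);
* registered `cellWalkRowSum` (`rowSum_le`): on the even torus `(ℤ/L)²`, `L ≥ 23`, `M > 2`, the row sum of an odd-row cell
  link is at most `2 · bubbleAbs 14 7 + 57 · 16 τ (2γ + τ) + Σ_{tdist v ≥ 8} 16 γ² q^{2(tdist v − 1)}`.
-/

noncomputable section

open scoped BigOperators Matrix Kronecker ComplexConjugate Matrix.Norms.L2Operator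
open Matrix Literature.MathematicalPhysics.QuantumLattice
open Summit.QuantumFields.QCD.Cruxes.CriticalLineDiamagnetism.ChessboardCellGain.CellKappa

namespace Summit.QuantumFields.QCD.Cruxes.CriticalLineDiamagnetism.ChessboardCellGain.CellWalk

variable {L : ℕ} [NeZero L]

/-! ### near partners are in the planar pattern -/

omit [NeZero L] in
/-- Membership in `nearLinks`. -/
theorem mem_nearLinks (R : ℕ) (l r : ℤ × ℤ) (hpar : (l.2 + r.2) % 2 ≠ 0) (hr : |r.1| + |r.2| ≤ R) :
    (l.1 + r.1, l.2 + r.2) ∈ nearLinks R l := by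
  have ha1 : |r.1| ≤ R := by linarith [abs_nonneg r.2]
  have ha2 : |r.2| ≤ R := by linarith [abs_nonneg r.1]
  rw [abs_le] at ha1 ha2
  have hw1 : (r.1 + R).toNat < 2 * R + 1 := by omega
  have hw2 : (r.2 + R).toNat < 2 * R + 1 := by omega
  unfold nearLinks
  simp only [List.mem_flatMap, List.mem_filterMap, List.bind_eq_flatMap, List.pure_def, List.mem_singleton,
    List.mem_range]
  refine ⟨((r.1 + R).toNat : ℤ), ⟨(r.1 + R).toNat, hw1, rfl⟩, ((r.2 + R).toNat : ℤ), ⟨(r.2 + R).toNat, hw2, rfl⟩, ?_⟩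
  have h1 : (((r.1 + R).toNat : ℕ) : ℤ) = r.1 + R := Int.toNat_of_nonneg (by omega)
  have h2 : (((r.2 + R).toNat : ℕ) : ℤ) = r.2 + R := Int.toNat_of_nonneg (by omega)
  simp only [h1, h2]
  rw [if_pos]
  · congr 1
    ext <;> simp only <;> ring
  · constructor
    · rw [show l.2 + (r.2 + (R : ℤ)) - R = l.2 + r.2 by ring]; exact hpar
    · rw [show l.1 + (r.1 + (R : ℤ)) - R - l.1 = r.1 by ring, show l.2 + (r.2 + (R : ℤ)) - R - l.2 = r.2 by ring]
      exact hr

/-- Odd-row partners within torus distance `7` come from the planar pattern `nearLinks 7`. -/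
theorem exists_near (hL2 : 2 ∣ L) (l : ℤ × ℤ) (hl : l.2 % 2 = 1) (xc xp : ZMod L × ZMod L)
    (hxc : xc.2.val % 2 = 1) (hxp : xp.2.val % 2 = 1) (hd : tdist (xp - xc) ≤ 7) :
    ∃ l' ∈ nearLinks 7 l, xp = xc + toTorus L (l' - l) := by
  set r : ℤ × ℤ := ((xp - xc).1.valMinAbs, (xp - xc).2.valMinAbs) with hr
  refine ⟨(l.1 + r.1, l.2 + r.2), mem_nearLinks 7 l r ?_ ?_, ?_⟩
  · -- parity: `r.2` is even
    have hcast : ((r.2 : ℤ) : ZMod L) = (xp.2.val : ZMod L) - (xc.2.val : ZMod L) := by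
      simp only [hr, ZMod.coe_valMinAbs, Prod.snd_sub, ZMod.natCast_zmod_val]
    have hdvd : (L : ℤ) ∣ r.2 - (xp.2.val - xc.2.val) := by
      rw [← ZMod.intCast_zmod_eq_zero_iff_dvd]; push_cast; rw [hcast, sub_self]
    have h2 : (2 : ℤ) ∣ r.2 - (xp.2.val - xc.2.val) := (Int.natCast_dvd_natCast.2 hL2).trans hdvd
    obtain ⟨m, hm⟩ := h2
    have hxc' : (xc.2.val : ℤ) % 2 = 1 := by exact_mod_cast hxc
    have hxp' : (xp.2.val : ℤ) % 2 = 1 := by exact_mod_cast hxp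
    omega
  · simp only [hr, Int.abs_eq_natAbs]
    unfold tdist at hd
    exact_mod_cast hd
  · simp only [toTorus, Prod.fst_sub, Prod.snd_sub, add_sub_cancel_left, hr, ZMod.coe_valMinAbs]
    ext <;> simp

omit [NeZero L] in
/-- For nonnegative `f`, the sum over the support of a list is at most the list sum. -/
theorem sum_toFinset_le_sum_map {ι : Type} [DecidableEq ι] (l : List ι) (f : ι → ℝ) (hf : ∀ i, 0 ≤ f i) :
    ∑ m ∈ l.toFinset, f m ≤ (l.map f).sum := by
  induction l with
  | nil => simp
  | cons a t ih =>
    rw [List.toFinset_cons, List.map_cons, List.sum_cons]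
    by_cases ha : a ∈ t.toFinset
    · rw [Finset.insert_eq_of_mem ha]; linarith [hf a]
    · rw [Finset.sum_insert ha]; linarith

/-- **Row sum split**: near partners against the planar-indexed list, far partners by decay. -/
theorem rowSum_split (M s₀ s₁ : ℝ) (hM : 2 < M) (hL2 : 2 ∣ L) (l : ℤ × ℤ) (hl : l.2 % 2 = 1)
    (xc : ZMod L × ZMod L) (hxc : xc.2.val % 2 = 1) :
    ∑ xp : ZMod L × ZMod L, (if xp.2.val % 2 = 1 then (1 : ℝ) else 0) * pairAbs L M s₀ s₁ xc xp ≤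
      ((nearLinks 7 l).map fun l' => pairAbs L M s₀ s₁ xc (xc + toTorus L (l' - l))).sum +
        ∑ v : ZMod L × ZMod L, (if 8 ≤ tdist v then
          16 * ((1 - 2 / M)⁻¹ * (1 / M)) ^ 2 * ((2 / M) ^ (tdist v - 1)) ^ 2 else 0) := by
  classical
  set φ : ℤ × ℤ → ZMod L × ZMod L := fun l' => xc + toTorus L (l' - l) with hφ
  set N : Finset (ZMod L × ZMod L) := ((nearLinks 7 l).map φ).toFinset with hN
  set F : ZMod L × ZMod L → ℝ := fun xp => (if xp.2.val % 2 = 1 then (1 : ℝ) else 0) * pairAbs L M s₀ s₁ xc xp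
    with hF
  have hpa0 : ∀ xp, 0 ≤ pairAbs L M s₀ s₁ xc xp := fun xp => by unfold pairAbs; positivity
  rw [← Finset.sum_add_sum_compl N F]
  refine add_le_add ?_ ?_
  · calc ∑ xp ∈ N, F xp ≤ ∑ xp ∈ N, pairAbs L M s₀ s₁ xc xp := Finset.sum_le_sum fun xp _ => by
            simp only [hF]; split_ifs
            · rw [one_mul]
            · rw [zero_mul]; exact hpa0 xp
      _ ≤ ((nearLinks 7 l).map fun l' => pairAbs L M s₀ s₁ xc (φ l')).sum := by
            have e1 : ((nearLinks 7 l).map φ).map (pairAbs L M s₀ s₁ xc) =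
                (nearLinks 7 l).map (fun l' => pairAbs L M s₀ s₁ xc (φ l')) := List.map_map
            rw [← e1, hN]
            exact sum_toFinset_le_sum_map _ _ hpa0
  · calc ∑ xp ∈ Nᶜ, F xp ≤ ∑ xp ∈ Nᶜ, (if 8 ≤ tdist (xp - xc) then
            16 * ((1 - 2 / M)⁻¹ * (1 / M)) ^ 2 * ((2 / M) ^ (tdist (xp - xc) - 1)) ^ 2 else 0) := by
          refine Finset.sum_le_sum fun xp hxp => ?_
          rw [Finset.mem_compl] at hxp
          simp only [hF]
          split_ifs with h1 h2
          · rw [one_mul]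
            have := pairAbs_far_le M s₀ s₁ hM xc (xp - xc)
            rwa [add_sub_cancel] at this
          · exfalso; apply hxp
            obtain ⟨l', hl', rfl⟩ := exists_near hL2 l hl xc xp hxc h1 (by omega)
            rw [hN, List.mem_toFinset, List.mem_map]; exact ⟨l', hl', rfl⟩
          · rw [zero_mul]; positivity
          · rw [zero_mul]
      _ ≤ ∑ xp, (if 8 ≤ tdist (xp - xc) then
            16 * ((1 - 2 / M)⁻¹ * (1 / M)) ^ 2 * ((2 / M) ^ (tdist (xp - xc) - 1)) ^ 2 else 0) :=
          Finset.sum_le_sum_of_subset_of_nonneg (Finset.subset_univ _) (fun _ _ _ => by split_ifs <;> positivity)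
      _ = _ := Equiv.sum_comp (Equiv.subRight xc) (fun v => if 8 ≤ tdist v then
            16 * ((1 - 2 / M)⁻¹ * (1 / M)) ^ 2 * ((2 / M) ^ (tdist v - 1)) ^ 2 else 0)

/-! ### The planar side -/

omit [NeZero L] in
/-- The near pattern: members of `nearLinks R l` are within `ℓ¹`-distance `R` of `l`. -/
theorem dist_le_of_mem_nearLinks (R : ℕ) (l l' : ℤ × ℤ) (h : l' ∈ nearLinks R l) :
    |l'.1 - l.1| + |l'.2 - l.2| ≤ R := by
  unfold nearLinks at h
  simp only [List.mem_flatMap, List.mem_filterMap, List.bind_eq_flatMap, List.pure_def, List.mem_singleton,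
    List.mem_range] at h
  obtain ⟨i, -, k, -, hik⟩ := h
  split_ifs at hik with hc
  simp only [Option.some.injEq] at hik
  subst hik
  exact hc.2

omit [NeZero L] in
/-- Unit scalars inside the bubble trace do not change its absolute value. -/
theorem norm_trace_strip (g₁ g₂ B₁ B₂ : Matrix (Fin 4) (Fin 4) ℂ) (c₁ c₂ : ℂ) (h₁ : ‖c₁‖ = 1) (h₂ : ‖c₂‖ = 1) :
    ‖(g₁ * c₁ • B₁ * g₂ * c₂ • B₂).trace‖ = ‖(g₁ * B₁ * g₂ * B₂).trace‖ := by
  simp only [Matrix.mul_smul, Matrix.smul_mul, Matrix.trace_smul, smul_eq_mul, norm_mul, h₁, h₂, one_mul]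

omit [NeZero L] in
/-- `‖−(±1)‖ = 1`. -/
theorem norm_neg_sign (p : Prop) [Decidable p] : ‖-(if p then (1 : ℂ) else -1)‖ = 1 := by
  rw [norm_neg]; split_ifs <;> simp

omit [NeZero L] in
/-- `‖±1‖ = 1`. -/
theorem norm_sign (p : Prop) [Decidable p] : ‖(if p then (1 : ℂ) else -1)‖ = 1 := by
  split_ifs <;> simp

omit [NeZero L] in
/-- The signed planar four-term bubble of `bubbleAbs` equals its sign-free form. -/
theorem planar_four_strip (M s₀ s₁ : ℝ) (a b : ℤ) (l' : ℤ × ℤ) :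
    ‖(propTrunc M s₀ s₁ 14 (a + 1 - l'.1, b - l'.2) * (-if l'.1 % 2 = 0 then (1 : ℂ) else -1) • pMinus 2 *
          propTrunc M s₀ s₁ 14 (l'.1 + 1 - a, l'.2 - b) * (-if a % 2 = 0 then (1 : ℂ) else -1) • pMinus 2).trace‖ +
        ‖(propTrunc M s₀ s₁ 14 (a + 1 - (l'.1 + 1), b - l'.2) * (if l'.1 % 2 = 0 then (1 : ℂ) else -1) • pPlus 2 *
          propTrunc M s₀ s₁ 14 (l'.1 - a, l'.2 - b) * (-if a % 2 = 0 then (1 : ℂ) else -1) • pMinus 2).trace‖ +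
      (‖(propTrunc M s₀ s₁ 14 (a - l'.1, b - l'.2) * (-if l'.1 % 2 = 0 then (1 : ℂ) else -1) • pMinus 2 *
          propTrunc M s₀ s₁ 14 (l'.1 + 1 - (a + 1), l'.2 - b) * (if a % 2 = 0 then (1 : ℂ) else -1) • pPlus 2).trace‖ +
        ‖(propTrunc M s₀ s₁ 14 (a - (l'.1 + 1), b - l'.2) * (if l'.1 % 2 = 0 then (1 : ℂ) else -1) • pPlus 2 *
          propTrunc M s₀ s₁ 14 (l'.1 - (a + 1), l'.2 - b) * (if a % 2 = 0 then (1 : ℂ) else -1) • pPlus 2).trace‖) =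
    ‖(propTrunc M s₀ s₁ 14 (a + 1 - l'.1, b - l'.2) * pMinus 2 * propTrunc M s₀ s₁ 14 (l'.1 + 1 - a, l'.2 - b) *
          pMinus 2).trace‖ +
      ‖(propTrunc M s₀ s₁ 14 (a + 1 - (l'.1 + 1), b - l'.2) * pPlus 2 * propTrunc M s₀ s₁ 14 (l'.1 - a, l'.2 - b) *
          pMinus 2).trace‖ +
      ‖(propTrunc M s₀ s₁ 14 (a - l'.1, b - l'.2) * pMinus 2 * propTrunc M s₀ s₁ 14 (l'.1 + 1 - (a + 1), l'.2 - b) *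
          pPlus 2).trace‖ +
      ‖(propTrunc M s₀ s₁ 14 (a - (l'.1 + 1), b - l'.2) * pPlus 2 * propTrunc M s₀ s₁ 14 (l'.1 - (a + 1), l'.2 - b) *
          pPlus 2).trace‖ := by
  rw [norm_trace_strip _ _ _ _ _ _ (norm_neg_sign _) (norm_neg_sign _),
    norm_trace_strip _ _ _ _ _ _ (norm_sign _) (norm_neg_sign _),
    norm_trace_strip _ _ _ _ _ _ (norm_neg_sign _) (norm_sign _),
    norm_trace_strip _ _ _ _ _ _ (norm_sign _) (norm_sign _)]
  ring

omit [NeZero L] in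
/-- `bubbleAbs 14 7` as the average over the two cell links of the sign-free planar four-term sums. -/
theorem bubbleAbs_eq (M s₀ s₁ : ℝ) : bubbleAbs M s₀ s₁ 14 7 = 1 / 4 *
    (((nearLinks 7 (0, 1)).map fun l' : ℤ × ℤ =>
      ‖(propTrunc M s₀ s₁ 14 (0 + 1 - l'.1, 1 - l'.2) * pMinus 2 * propTrunc M s₀ s₁ 14 (l'.1 + 1 - 0, l'.2 - 1) *
          pMinus 2).trace‖ +
      ‖(propTrunc M s₀ s₁ 14 (0 + 1 - (l'.1 + 1), 1 - l'.2) * pPlus 2 * propTrunc M s₀ s₁ 14 (l'.1 - 0, l'.2 - 1) *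
          pMinus 2).trace‖ +
      ‖(propTrunc M s₀ s₁ 14 (0 - l'.1, 1 - l'.2) * pMinus 2 * propTrunc M s₀ s₁ 14 (l'.1 + 1 - (0 + 1), l'.2 - 1) *
          pPlus 2).trace‖ +
      ‖(propTrunc M s₀ s₁ 14 (0 - (l'.1 + 1), 1 - l'.2) * pPlus 2 * propTrunc M s₀ s₁ 14 (l'.1 - (0 + 1), l'.2 - 1) *
          pPlus 2).trace‖).sum +
    ((nearLinks 7 (1, 1)).map fun l' : ℤ × ℤ =>
      ‖(propTrunc M s₀ s₁ 14 (1 + 1 - l'.1, 1 - l'.2) * pMinus 2 * propTrunc M s₀ s₁ 14 (l'.1 + 1 - 1, l'.2 - 1) *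
          pMinus 2).trace‖ +
      ‖(propTrunc M s₀ s₁ 14 (1 + 1 - (l'.1 + 1), 1 - l'.2) * pPlus 2 * propTrunc M s₀ s₁ 14 (l'.1 - 1, l'.2 - 1) *
          pMinus 2).trace‖ +
      ‖(propTrunc M s₀ s₁ 14 (1 - l'.1, 1 - l'.2) * pMinus 2 * propTrunc M s₀ s₁ 14 (l'.1 + 1 - (1 + 1), l'.2 - 1) *
          pPlus 2).trace‖ +
      ‖(propTrunc M s₀ s₁ 14 (1 - (l'.1 + 1), 1 - l'.2) * pPlus 2 * propTrunc M s₀ s₁ 14 (l'.1 - (1 + 1), l'.2 - 1) *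
          pPlus 2).trace‖).sum) := by
  unfold bubbleAbs
  simp only [cellLinks, linkBlocks, List.map, List.sum_cons, List.sum_nil, add_zero, ← List.sum_map_add]
  rw [show (fun l' : ℤ × ℤ => _) = _ from funext fun l' => planar_four_strip M s₀ s₁ 0 1 l',
    show (fun l' : ℤ × ℤ => _) = _ from funext fun l' => planar_four_strip M s₀ s₁ 1 1 l']


/-- The near list of a cell link against the planar table. -/
theorem nearList_le (M s₀ s₁ : ℝ) (hM : 2 < M) (hL : (23 : ℤ) ≤ L) (a b : ℤ) (c : ℤ × ℤ) :
    ((nearLinks 7 (a, b)).map fun l' => pairAbs L M s₀ s₁ (toTorus L ((a, b) + c))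
        (toTorus L ((a, b) + c) + toTorus L (l' - (a, b)))).sum ≤
      ((nearLinks 7 (a, b)).map fun l' : ℤ × ℤ =>
        ‖(propTrunc M s₀ s₁ 14 (a + 1 - l'.1, b - l'.2) * pMinus 2 * propTrunc M s₀ s₁ 14 (l'.1 + 1 - a, l'.2 - b) *
            pMinus 2).trace‖ +
        ‖(propTrunc M s₀ s₁ 14 (a + 1 - (l'.1 + 1), b - l'.2) * pPlus 2 * propTrunc M s₀ s₁ 14 (l'.1 - a, l'.2 - b) *
            pMinus 2).trace‖ +
        ‖(propTrunc M s₀ s₁ 14 (a - l'.1, b - l'.2) * pMinus 2 * propTrunc M s₀ s₁ 14 (l'.1 + 1 - (a + 1), l'.2 - b) *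
            pPlus 2).trace‖ +
        ‖(propTrunc M s₀ s₁ 14 (a - (l'.1 + 1), b - l'.2) * pPlus 2 * propTrunc M s₀ s₁ 14 (l'.1 - (a + 1), l'.2 - b) *
            pPlus 2).trace‖).sum +
      ((nearLinks 7 (a, b)).length : ℝ) * (4 * (4 * ((2 / M) ^ (14 + 1) * (1 - 2 / M)⁻¹ * (1 / M)) *
        (2 * ((1 - 2 / M)⁻¹ * (1 / M)) + (2 / M) ^ (14 + 1) * (1 - 2 / M)⁻¹ * (1 / M)))) := by
  rw [show ((nearLinks 7 (a, b)).length : ℝ) * (4 * (4 * ((2 / M) ^ (14 + 1) * (1 - 2 / M)⁻¹ * (1 / M)) *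
        (2 * ((1 - 2 / M)⁻¹ * (1 / M)) + (2 / M) ^ (14 + 1) * (1 - 2 / M)⁻¹ * (1 / M)))) =
      ((nearLinks 7 (a, b)).map fun _ => (4 * (4 * ((2 / M) ^ (14 + 1) * (1 - 2 / M)⁻¹ * (1 / M)) *
        (2 * ((1 - 2 / M)⁻¹ * (1 / M)) + (2 / M) ^ (14 + 1) * (1 - 2 / M)⁻¹ * (1 / M))))).sum by
      rw [List.map_const', List.sum_replicate, nsmul_eq_mul], ← List.sum_map_add]
  refine List.sum_le_sum fun l' hl' => ?_
  have hnear := dist_le_of_mem_nearLinks 7 (a, b) l' hl'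
  rw [← toTorus_add, show (a, b) + c + (l' - (a, b)) = l' + c by abel]
  exact pairAbs_near_le M s₀ s₁ hM a b l' c hnear hL

/-- **Row sum bound**: for a cell link in an odd row, the sum over all partner links in odd rows of the pair bubbles is at
most `2 · bubbleAbs 14 7` plus the truncation and far tails. -/
theorem rowSum_le (M s₀ s₁ : ℝ) (hM : 2 < M) (hL : (23 : ℤ) ≤ L) (hL2 : 2 ∣ L) (xc : ZMod L × ZMod L)
    (hxc : xc.2.val % 2 = 1) :
    ∑ xp : ZMod L × ZMod L, (if xp.2.val % 2 = 1 then (1 : ℝ) else 0) * pairAbs L M s₀ s₁ xc xp ≤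
      2 * bubbleAbs M s₀ s₁ 14 7 +
        57 * (4 * (4 * ((2 / M) ^ (14 + 1) * (1 - 2 / M)⁻¹ * (1 / M)) *
          (2 * ((1 - 2 / M)⁻¹ * (1 / M)) + (2 / M) ^ (14 + 1) * (1 - 2 / M)⁻¹ * (1 / M)))) +
        ∑ v : ZMod L × ZMod L, (if 8 ≤ tdist v then
          16 * ((1 - 2 / M)⁻¹ * (1 / M)) ^ 2 * ((2 / M) ^ (tdist v - 1)) ^ 2 else 0) := by
  have h01 := rowSum_split M s₀ s₁ hM hL2 (0, 1) (by decide) xc hxc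
  have h11 := rowSum_split M s₀ s₁ hM hL2 (1, 1) (by decide) xc hxc
  have hx : ∀ a b : ℤ, toTorus L ((a, b) + (((xc.1.val : ℤ) - a), ((xc.2.val : ℤ) - b))) = xc := by
    intro a b
    simp only [toTorus, Prod.mk_add_mk, add_sub_cancel]
    ext <;> simp
  have n01 := nearList_le M s₀ s₁ hM hL 0 1 (((xc.1.val : ℤ) - 0), ((xc.2.val : ℤ) - 1))
  have n11 := nearList_le M s₀ s₁ hM hL 1 1 (((xc.1.val : ℤ) - 1), ((xc.2.val : ℤ) - 1))
  rw [hx] at n01 n11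
  have hlen0 : ((nearLinks 7 ((0 : ℤ), (1 : ℤ))).length : ℝ) = 57 := by
    rw [show (nearLinks 7 ((0 : ℤ), (1 : ℤ))).length = 57 by decide]; norm_num
  have hlen1 : ((nearLinks 7 ((1 : ℤ), (1 : ℤ))).length : ℝ) = 57 := by
    rw [show (nearLinks 7 ((1 : ℤ), (1 : ℤ))).length = 57 by decide]; norm_num
  rw [hlen0] at n01
  rw [hlen1] at n11
  have hb := bubbleAbs_eq M s₀ s₁
  linarith

/-! ### Registered summary -/

/-- **Aux theorem `cellWalkRowSum`** (registered helper of `cellSecondOrder`): the row sum of the pair bubbles of an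
odd-row cell link of the even torus `(ℤ/L)²` (`L ≥ 23`, `M > 2`) against the certified planar table. -/
theorem cellWalkRowSum : ∀ (L : ℕ) [NeZero L] (M s₀ s₁ : ℝ), 2 < M → (23 : ℤ) ≤ L → 2 ∣ L → ∀ (xc : ZMod L × ZMod L), xc.2.val % 2 = 1 → ∑ xp : ZMod L × ZMod L, (if xp.2.val % 2 = 1 then (1 : ℝ) else 0) * pairAbs L M s₀ s₁ xc xp ≤ 2 * CellKappa.bubbleAbs M s₀ s₁ 14 7 + 57 * (4 * (4 * ((2 / M) ^ (14 + 1) * (1 - 2 / M)⁻¹ * (1 / M)) * (2 * ((1 - 2 / M)⁻¹ * (1 / M)) + (2 / M) ^ (14 + 1) * (1 - 2 / M)⁻¹ * (1 / M)))) + ∑ v : ZMod L × ZMod L, (if 8 ≤ tdist v then 16 * ((1 - 2 / M)⁻¹ * (1 / M)) ^ 2 * ((2 / M) ^ (tdist v - 1)) ^ 2 else 0) :=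
  fun _ _ M s₀ s₁ hM hL hL2 xc hxc => rowSum_le M s₀ s₁ hM hL hL2 xc hxc

end Summit.QuantumFields.QCD.Cruxes.CriticalLineDiamagnetism.ChessboardCellGain.CellWalk

end
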